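import Literature.MathematicalPhysics.QuantumFieldTheory.Balaban1983to89.B9CubeDirInverseBondCAtMemberBlocksY
import Literature.MathematicalPhysics.QuantumFieldTheory.Balaban1983to89.B9CoReadingCoordsTranspose
import Literature.MathematicalPhysics.QuantumFieldTheory.Balaban1983to89.B9PinMembersKLevelV1
import Literature.MathematicalPhysics.QuantumFieldTheory.Balaban1983to89.B9BondReadDomainsPinY
import Literature.MathematicalPhysics.QuantumFieldTheory.Balaban1983to89.B9Eq337CutFieldDirY
import Literature.MathematicalPhysics.QuantumFieldTheory.Balaban1983to89.B9Cor36GpDirMemberBlocksAtRecordY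

/-!
# `Balaban1983to89.B9CubeDirInverseBondCMemberRowsAtRecordY` — [Balaban1985BackgroundPropagators] COROLLARY 3.6 p. 408 ∕ THM 3.3 p. 399 ∕ p. 409 l. 1–5 FOR PRINT's
# DIRICHLET BOND LETTER OF THE CUBE SEQUENCE AT THE N06 RECORD: the heads' bond row `h36Ab` and regime clause `hUnitA` AT A MEMBER `x` AND ITS CONFIGURATION `U`,
# FROM THE CUBE-SIDE ROWS AT A SMALL FIELD — the supplier's deliverable BUNDLED (`CubeRowsGDirCY`) and the heads' two rows DERIVED from it in the heads' own currency

T. Bałaban, *Propagators for lattice gauge theories in a background field*, Commun. Math. Phys. **99** (1985) 389–434 [`Balaban1985BackgroundPropagators`, "B9"]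
(held `paper:balaban1985-cmp99-background-propagators`; journal page = PDF page + 388); [4] = T. Bałaban, *Propagators and renormalization transformations for lattice
gauge theories. II*, Commun. Math. Phys. **96** (1984) 223–250 [`Balaban1984PropagatorsII`].

statement-level skeleton of published theorems with citation tags; proofs where landed; nothing here is a claim about the Yang–Mills mass gap

THE PRINTED LOCI.  Cor. 3.6 p. 408 («This follows from Corollary 3.5 applied to the configuration U′ = U^u, and we have to recall only that all the results of these
theorems are gauge invariant»); p. 409 l. 1–5 («The operators constructed for this sequence, which we denote by G′_□(U), C_□(U), G_□(U), satisfy all the inequalities of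
Theorems 3.1–3.3 correspondingly. This is the basis of all estimates for the expansions we will construct»); Thm 3.3 p. 399 («with G′(U) replaced by G(U) and λ replaced
by a function J defined at bonds»); Thm 3.1 (3.42) p. 397; (3.35) p. 396 (the per-cube gauge datum).  [4] (2.51)–(2.52) p. 232, Lemma 2.1 (2.61) p. 234.

WHY THIS FILE (cell `pub-ymgap`, HUMAN RULING D-0062, node N06 [B9]; seat `pub-ymgap-dag-n06-d` g35 — the knit at ₁₁).  The heads of record «KE₁₉X-C» ∕ «KESC-CM» display,
for the Dirichlet bond letter of record `G_□(U) = GDirCKY x.toKIdx □ (DPDsDirCubeY … Ω₀(□)) (bondsOverY Ω₀(□)) U`, the estimate row `h36Ab` (the four (3.42) block majorants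
of `conj b(G_□(U))`, `conj b(∇_{U,ν})·conj b(G_□(U))`, `conj b(G_□(U))·conj b(∇*_{U,ν})`, `conj b(Δ_U)·conj b(G_□(U))` over the member's all-blocks geometry
`toB6 (geoBY x) 1 (H x)` keyed by `y(b₋)`, basis `trBasis N`, constants `(BcA, q.δ₀)`) and the regime clause `hUnitA` (`IsUnit padΔ_{loc,□}[Q^knit_□](U)`), at every `U`
of the (3.35) class.  The supplier (dag-n06-c, road (B5)) proves Cor. 3.5 ∕ (3.85) for this letter AT A SMALL FIELD `Ṽ` over the CUBE SEQUENCE's blocks; ✓p831406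
`B9CubeDirInverseBondCAtMemberBlocksY.gDirCK_at_member_blocks_of_entries` transfers `Ṽ ↦ U`.  THIS FILE fixes the interface between the two in the heads' currency:
* §1 ★ `CubeRowsGDirCY i □ U dB B δ α` — THE SUPPLIER's DELIVERABLE AT `(□, U)`, BUNDLED: a unitary-valued gauge `u`, a configuration `Ṽ` with `AgreeDirCY Ω₀(□) (Uᵘ) Ṽ`
  (the (3.35) datum as the letter reads it), a cube-geometry tag `(Rr, Hc)`, (2.61) on the cube geometry at the splitting exponent `α`, the unit clause at `Ṽ`, and the four
  cube-side rows of `conj (trBasis N)(G_□(Ṽ))` (+ the `∇_{Ṽ,ν} ∕ ∇*_{Ṽ,ν} ∕ Δ_{Ṽ}` words) over `(toB6 (geoCK i □) Rr Hc, blkBK i □)` with constants `B·ℓ_□^{2,1,1,0}·e^{−δd_□}`;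
* §2 ★★ `hUnitA_of_cubeRows` (the regime clause at `U`) and ★★ `gDirCK_rows_at_member_of_cubeRows` (the four rows at `U` over `toB6 (geoBK i) Rr′ Hp`, constant
  `(c_b·Σ‖b‖)²·B·c₁(dB,δ,α)` with `c_b = coordBound39 (trBasis N)`, rate `(1−α)δ`) — one application of ✓`gDirCK_at_member_blocks_of_entries` at `b := trBasis N`, `M₂ := c_b`
  (✓`abs_repr_le`);
* §3 ★★★ `h36Ab_at_member_of_cubeRows` — THE HEADS' ROW `h36Ab` AT `x, U` VERBATIM (geometry `toB6 (geoBY x) 1 H`, `geoBY x = geoBK x.toKIdx` by `rfl`), from `CubeRowsGDirCY` at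
  every cover cube and ANY dominated pair `(BcA, δ₀)`: `(c_b·Σ‖b‖)²·B·c₁ ≤ BcA`, `δ₀ ≤ (1−α)δ` (kernel monotonicity) — the shape of ✓`B9Cor36GpDirMemberBlocksAtRecordY.h36b_at_member`.
The edition of the heads that CONSUMES `h36Ab` ∕ `hUnitA` then displays `∀ x U ∈ Reg335, ∀ □, CubeRowsGDirCY x.toKIdx □ U dB B δ α` (print's Cor. 3.5 at the datum, the
supplier's exact target) plus the two threshold rows, and nothing else of the bond letter.
* §4 (v1.1, LOCATED-35) ★★ HOW THE SUPPLIER INHABITS THE BUNDLE WITHOUT TOUCHING `AgreeDirCY`: `agreeDirCY_refl` ∕ ★ `cubeRowsGDirCY_of_gauge` (rows proved directly at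
  `Ṽ := Uᵘ`), and — for a CUT small field `Ṽ := cutCfgS i T η A` (✓`B9Eq337CutFieldDirY`: `e^{iηA}` on the bonds with both endpoints in `T`, `1` elsewhere) — ★ `agree_read_gaugeY_cutCfgS`
  (on every read site the bond variables of `Uᵘ` and of the cut field coincide once `T` contains the site, its forward and its backward neighbours and the datum box `Q` covers `T`),
  ★★ `agreeDirCY_gaugeY_cutCfgS` (hence `AgreeDirCY Ω₀(□) (Uᵘ) (cutCfgS T η A)` for `T ⊇` the one-layer thickening of the pinned reading set `nearAPinCY □ Ω₀(□)`), and ★★★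
  `cubeRowsGDirCY_of_cutDatum` (the bundle from a unitary `u`, a potential `A`, such a `T` and `Q`, (2.61), the unit clause and the four rows AT `cutCfgS T η A`).  WHY `T ⊋ Ω₀(□)`:
  the hessian ∕ curvature part of `Δ_{loc,□}` at a bond over `Ω₀` reads every edge of every plaquette through it, some of which EXIT `Ω₀` — the cut at `Ω₀` itself (right for the SITE
  letter, ✓`padDeltaCubeY_cutCfgS_eq_gaugeY`) gives a bond operator NOT gauge-equivalent to `G_□(U)`.
* §5 (v1.2, seat g35) THE CANONICAL CUT SET AND THE BOND DATUM: ★ `bondCutSetY i □` (`nearAPinCY □ Ω₀(□)` with its `±e_μ` translates — the named `T` of §4), `hT_bondCutSetY`,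
  `dirDomY_subset_bondCutSetY`; ★ `DatumBondUY i □ U a₁` — dag-n06-c's unitary site datum ✓`Datum36UY` with the box clause `Q ⊇ chart⁻¹Ω₀(□)` STRENGTHENED to `Q ⊇ chart⁻¹(bondCutSetY)`
  (one datum serving both sectors: `datum36UY_of_datumBondUY`); ★★ `cubeRowsGDirCY_of_bondCut` — §4's inhabitation at `T := bondCutSetY i □`.

HONEST SCOPE ∕ NOT CLAIMED.  One bundling `def … : Prop` with body (no `def X : Prop` fact) + unpacking + one application of the landed transfer + kernel monotonicity; NO
estimate: the cube-side rows and the datum are the displayed INPUT (dag-n06-c's road (B5); LOCATED-32 for the datum on non-class cubes stands).  The heads are NOT edited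
by this file.  Count-neutral; N06 NOT discharged; nothing on `d = 4`, the continuum, reflection positivity, the mass gap or Clay; YM mass gap NOT proved.  No `sorry`, no
`axiom`, no `instance`, no `notation`.  NEW file; nothing landed is modified.  `--supports stmt-QuantumFields-27239`.  Net new unproved facts: 0.

RELATED IN THE TREE, NOT DUPLICATED (searched 2026-08-31 19:2xZ: `rg` for the basename and the four decl names over `lean/Literature/MathematicalPhysics` +
`lean/Summits/QuantumFields` — 0 hits): ✓`B9CubeDirInverseBondCAtMemberBlocksY` (the transfer USED), ✓`B9Cor36GpDirMemberBlocksAtRecordY` (the site-sector pattern: `Datum36Y`,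
`h36b_at_member`), dag-n06-c `B9Cor35GDirAtCubeLetters.cor35_GDir_rows_of_pieces` (the cube-side G-step whose output, after the flat→covariant conversion at `Ṽ`, inhabits
the four rows of `CubeRowsGDirCY`).
-/

noncomputable section

namespace Literature.MathematicalPhysics.QuantumFieldTheory.Balaban1983to89.B9CubeDirInverseBondCMemberRowsAtRecordY

open B6RandomWalk (HasMajorant hasMajorant_mono Ineq261 c1_nonneg)
open B9Thm34Ext (toB6)
open B9Eq352DivFormLetters (conj)
open B6KLevelCensusIndexV1 (KIdx)
open B6Cover236MultiLevelBlocks (cubes)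
open B6GlobalChartV1 (blkV1)
open B9CubeGeometryInputs (geoCK)
open B9Cor35GCubeInputsAtOne (blkBK)
open B9SectBAllBlocksGeometryY (geoBK geoBY geoBK_len_pos geoBK_dist_nonneg)
open B9PinMembersKLevelV1 (MemberY)
open B9Thm39ReadingCoords (coordBound39 abs_repr_le)
open B9CoReadingCoordsTranspose (TrIdx trBasis)
open B9CoReadingCoords (cdBₗ cdsBₗ lapBₗ)
open B9DirichletBondCubePairY (padDeltaLocCY)
open B9Eq3115KnitCubeLetterY (knitDepP QknitCubeY QsknitCubeY GDirCKY)
open B9Cor35GpDirInputsAtOne (dirDomY)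
open B9CubeDirInverseBondCLocalityAtRecordY (AgreeDirCY)
open B9CubeDirInverseBondCAtMemberBlocksY (gDirCK_at_member_blocks_of_entries isUnit_padDeltaLocCKY_of_datum)
open B7Prop2Explicit (unitaryUnits)
open Node00
open Node00.OpsYCubeDirInverseBond (bondsOverY)
open Node00.OpsYCubeProjectionG (DPDsDirCubeY)
open scoped Matrix Matrix.Norms.L2Operator

variable {d ℓ : ℕ} {hd : 1 ≤ d + 1} {hL : Odd (ℓ + 1) ∧ 1 < ℓ + 1} {b₀ b₁ : ℝ} {N : ℕ} [Nonempty (Fin N)]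

/-! ## §1  The supplier's deliverable at `(□, U)`, bundled -/

section Bundle

/-- ★ **THE CUBE-SIDE (3.42) ROWS OF PRINT's DIRICHLET BOND LETTER `G_□` AT A SMALL FIELD, WITH ITS (3.35) DATUM, AT `(□, U)`** — the supplier's deliverable, bundled:
a unitary-valued gauge function `u` and a configuration `Ṽ` agreeing with `Uᵘ` on everything `G_□` reads (`AgreeDirCY Ω₀(□) (Uᵘ) Ṽ`; `Ṽ := Uᵘ` is allowed), a tag
`(Rr, Hc)` of the cube geometry, (2.61) on the cube geometry at the splitting exponent `α` (`Ineq261 dB`), the unit clause `IsUnit padΔ_{loc,□}[Q^knit_□](Ṽ)`, and the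
four rows of `conj b(G_□(Ṽ))`, `conj b(∇_{Ṽ,ν})·conj b(G_□(Ṽ))`, `conj b(G_□(Ṽ))·conj b(∇*_{Ṽ,ν})`, `conj b(Δ_{Ṽ})·conj b(G_□(Ṽ))` (`b = trBasis N`) over the cube sequence's
bond carrier `(toB6 (geoCK i □) Rr Hc, blkBK i □)` with kernels `B·ℓ_□(a)^{2,1,1,0}·e^{−δ·d_□(a,s)}` — Cor. 3.5 ∕ Thm 3.3 for the sequence `{Ω_n(□)}` at the configuration
`U′ = Uᵘ` of Cor. 3.6's proof.  OURS (bundling). [cite: Balaban1985BackgroundPropagators, Cor. 3.6 p.408, Cor. 3.5 p.407, Thm 3.3 p.399, Thm 3.1 (3.42) p.397, (3.35) p.396, p.409 l.1–5; Balaban1984PropagatorsII, (2.51) p.232, Lemma 2.1 (2.61) p.234] -/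
def CubeRowsGDirCY (i : KIdx d ℓ hd hL b₀ b₁) (c : ↥(cubes (toKT i).D.toDomains)) (U : CfgY (Matrix (Fin N) (Fin N) ℂ) i) (dB : ℕ) (B δ α : ℝ) : Prop :=
  ∃ (u : GaugeY (Matrix (Fin N) (Fin N) ℂ) i) (V : CfgY (Matrix (Fin N) (Fin N) ℂ) i) (Rr : ℝ) (Hc : Prop),
    (∀ z, u z ∈ unitaryUnits (Matrix (Fin N) (Fin N) ℂ)) ∧
    AgreeDirCY i c (fun ι => knitDepP i ι.1) (dirDomY i c) (gaugeY i u U) V ∧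
    Ineq261 dB (toB6 (geoCK i c) Rr Hc) δ α ∧
    IsUnit (padDeltaLocCY i c (QknitCubeY i c) (QsknitCubeY i c) (DPDsDirCubeY i c (dirDomY i c)) (bondsOverY i (dirDomY i c)) V) ∧
    HasMajorant (g := toB6 (geoCK i c) Rr Hc) (blkBK i c)
      (conj (trBasis N) ((GDirCKY i c (DPDsDirCubeY i c (dirDomY i c)) (bondsOverY i (dirDomY i c)) V).restrictScalars ℝ))
      (fun a s => B * (geoCK i c).len a ^ 2 * Real.exp (-(δ * (geoCK i c).dist a s))) ∧
    (∀ ν : Fin (d + 1), HasMajorant (g := toB6 (geoCK i c) Rr Hc) (blkBK i c)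
      (conj (trBasis N) (cdBₗ i V ν) * conj (trBasis N) ((GDirCKY i c (DPDsDirCubeY i c (dirDomY i c)) (bondsOverY i (dirDomY i c)) V).restrictScalars ℝ))
      (fun a s => B * (geoCK i c).len a * Real.exp (-(δ * (geoCK i c).dist a s)))) ∧
    (∀ ν : Fin (d + 1), HasMajorant (g := toB6 (geoCK i c) Rr Hc) (blkBK i c)
      (conj (trBasis N) ((GDirCKY i c (DPDsDirCubeY i c (dirDomY i c)) (bondsOverY i (dirDomY i c)) V).restrictScalars ℝ) * conj (trBasis N) (cdsBₗ i V ν))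
      (fun a s => B * (geoCK i c).len a * Real.exp (-(δ * (geoCK i c).dist a s)))) ∧
    HasMajorant (g := toB6 (geoCK i c) Rr Hc) (blkBK i c)
      (conj (trBasis N) (lapBₗ i V) * conj (trBasis N) ((GDirCKY i c (DPDsDirCubeY i c (dirDomY i c)) (bondsOverY i (dirDomY i c)) V).restrictScalars ℝ))
      (fun a s => B * Real.exp (-(δ * (geoCK i c).dist a s)))

end Bundle

/-! ## §2  The regime clause and the four rows AT `U` over the member's all-blocks geometry -/

section Member

variable (i : KIdx d ℓ hd hL b₀ b₁) (c : ↥(cubes (toKT i).D.toDomains)) {U : CfgY (Matrix (Fin N) (Fin N) ℂ) i} {dB : ℕ} {B δ α : ℝ}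

/-- ★★ **THE HEADS' REGIME CLAUSE `hUnitA` AT `(□, U)` FROM THE DELIVERABLE** (locality `Ṽ ↦ Uᵘ`, covariance `Uᵘ ↦ U`: ✓`isUnit_padDeltaLocCKY_of_datum`).
[cite: Balaban1985BackgroundPropagators, Cor. 3.6 p.408, (3.34) p.396, p.409 l.3–5] -/
theorem hUnitA_of_cubeRows (h : CubeRowsGDirCY i c U dB B δ α) :
    IsUnit (padDeltaLocCY i c (QknitCubeY i c) (QsknitCubeY i c) (DPDsDirCubeY i c (dirDomY i c)) (bondsOverY i (dirDomY i c)) U) := by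
  obtain ⟨u, V, _, _, hg, hAgr, _, hV, _⟩ := h
  exact isUnit_padDeltaLocCKY_of_datum i c U V hg (dirDomY i c) hAgr hV

/-- ★★ **THE FOUR ROWS AT `U` OVER THE MEMBER's ALL-BLOCKS GEOMETRY FROM THE DELIVERABLE** (one application of ✓`gDirCK_at_member_blocks_of_entries` at `b := trBasis N`,
`M₂ := coordBound39 (trBasis N)`, ✓`abs_repr_le`): constant `(c_b·Σ‖b‖)²·B·c₁(dB,δ,α)`, weights `ℓ^{2,1,1,0}`, rate `(1−α)δ`.
[cite: Balaban1985BackgroundPropagators, Cor. 3.6 p.408 l.1–14, Thm 3.1 (3.42) p.397, Thm 3.3 p.399, p.409 l.1–5; Balaban1984PropagatorsII, (2.51)–(2.52) p.232, Lemma 2.1 (2.61) p.234] -/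
theorem gDirCK_rows_at_member_of_cubeRows [Fintype (geoBK i).Site] (Rr' : ℝ) (Hp : Prop) (hB : 0 ≤ B) (hδ : 0 ≤ δ) (hα1 : α ≤ 1)
    (h : CubeRowsGDirCY i c U dB B δ α) :
    HasMajorant (g := toB6 (geoBK i) Rr' Hp) (fun p : FBondY i × TrIdx N => blkV1 i.hN i.D p.1)
        (conj (trBasis N) ((GDirCKY i c (DPDsDirCubeY i c (dirDomY i c)) (bondsOverY i (dirDomY i c)) U).restrictScalars ℝ))
        (fun a a' => (coordBound39 (trBasis N) * ∑ j, ‖trBasis N j‖) ^ 2 * (B * B6.c1 dB δ α) * (geoBK i).len a ^ 2 *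
          Real.exp (-((1 - α) * δ * (geoBK i).dist a a'))) ∧
      (∀ ν : Fin (d + 1), HasMajorant (g := toB6 (geoBK i) Rr' Hp) (fun p : FBondY i × TrIdx N => blkV1 i.hN i.D p.1)
        (conj (trBasis N) (cdBₗ i U ν) * conj (trBasis N) ((GDirCKY i c (DPDsDirCubeY i c (dirDomY i c)) (bondsOverY i (dirDomY i c)) U).restrictScalars ℝ))
        (fun a a' => (coordBound39 (trBasis N) * ∑ j, ‖trBasis N j‖) ^ 2 * (B * B6.c1 dB δ α) * (geoBK i).len a *
          Real.exp (-((1 - α) * δ * (geoBK i).dist a a')))) ∧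
      (∀ ν : Fin (d + 1), HasMajorant (g := toB6 (geoBK i) Rr' Hp) (fun p : FBondY i × TrIdx N => blkV1 i.hN i.D p.1)
        (conj (trBasis N) ((GDirCKY i c (DPDsDirCubeY i c (dirDomY i c)) (bondsOverY i (dirDomY i c)) U).restrictScalars ℝ) * conj (trBasis N) (cdsBₗ i U ν))
        (fun a a' => (coordBound39 (trBasis N) * ∑ j, ‖trBasis N j‖) ^ 2 * (B * B6.c1 dB δ α) * (geoBK i).len a *
          Real.exp (-((1 - α) * δ * (geoBK i).dist a a')))) ∧
      HasMajorant (g := toB6 (geoBK i) Rr' Hp) (fun p : FBondY i × TrIdx N => blkV1 i.hN i.D p.1)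
        (conj (trBasis N) (lapBₗ i U) * conj (trBasis N) ((GDirCKY i c (DPDsDirCubeY i c (dirDomY i c)) (bondsOverY i (dirDomY i c)) U).restrictScalars ℝ))
        (fun a a' => (coordBound39 (trBasis N) * ∑ j, ‖trBasis N j‖) ^ 2 * (B * B6.c1 dB δ α) * 1 *
          Real.exp (-((1 - α) * δ * (geoBK i).dist a a'))) := by
  obtain ⟨u, V, Rr, Hc, hg, hAgr, h261, _, E0, E1, E2, E3⟩ := h
  exact gDirCK_at_member_blocks_of_entries i c U V (trBasis N) (norm_nonneg _) (abs_repr_le (trBasis N)) hg (dirDomY i c) hAgr Rr Hc Rr' Hp dB hB hδ hα1 h261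
    E0 E1 E2 E3

end Member

/-! ## §3  The heads' row `h36Ab` at a member, verbatim, from the deliverable at every cover cube -/

section Heads

variable {Mstar : ℕ}

/-- kernel monotonicity `B_m·l·e^{−δe} ≤ B_c·l·e^{−δ₀e}` for `B_m ≤ B_c`, `δ₀ ≤ δ`, `l, e ≥ 0`. [folklore] -/
private theorem kernel_mono {Bm Bc δ δ₀ l e : ℝ} (hBm : 0 ≤ Bm) (hBc : Bm ≤ Bc) (hδ : δ₀ ≤ δ) (hl : 0 ≤ l) (he : 0 ≤ e) :
    Bm * l * Real.exp (-(δ * e)) ≤ Bc * l * Real.exp (-(δ₀ * e)) :=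
  mul_le_mul (mul_le_mul_of_nonneg_right hBc hl) (Real.exp_le_exp.2 (by nlinarith)) (Real.exp_nonneg _) (mul_nonneg (hBm.trans hBc) hl)

/-- ★★★ **THE HEADS' ROW `h36Ab` AT A MEMBER `x` AND ITS CONFIGURATION `U`, FROM THE CUBE-SIDE ROWS AT THE DATUM** («all the results of these theorems are gauge invariant,
so they hold for the configuration U also», FOR `G_□(U)` OF p. 409 l. 3–5 in the letter of record): if every cover cube `□` of the member carries the deliverable
`CubeRowsGDirCY x.toKIdx □ U dB B δ α` (`0 ≤ B`, `0 ≤ δ`, `α ≤ 1`), then for ANY pair `(BcA, δ₀)` with `(c_b·Σ‖b‖)²·B·c₁(dB,δ,α) ≤ BcA` and `δ₀ ≤ (1−α)δ` the four clauses of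
the heads' `h36Ab` at `x, U` hold verbatim — geometry `toB6 (geoBY x) 1 H` keyed by `y(b₋)`, basis `trBasis N`, the member's `∇_{U,ν} ∕ ∇*_{U,ν} ∕ Δ_U`.
[cite: Balaban1985BackgroundPropagators, Cor. 3.6 p.408 l.1–14, (3.34) p.396, Thm 3.1 (3.42) p.397, Thm 3.3 p.399, p.409 l.1–5, p.410 l.14–15; Balaban1984PropagatorsII, (2.51)–(2.55) p.232, Lemma 2.1 (2.61) p.234] -/
theorem h36Ab_at_member_of_cubeRows {θd θℓ : ℕ} {θhd : 1 ≤ θd + 1} {θhL : Odd (θℓ + 1) ∧ 1 < θℓ + 1} {θb₀ θb₁ : ℝ}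
    (x : MemberY θd θℓ θhd θhL θb₀ θb₁ Mstar) [Fintype (geoBY x).Site] (H : Prop) (U : CfgY (Matrix (Fin N) (Fin N) ℂ) x.toKIdx)
    {dB : ℕ} {B δ α : ℝ} (hB : 0 ≤ B) (hδ : 0 ≤ δ) (hα1 : α ≤ 1)
    (h : ∀ c' : ↥(cubes x.toKIdx.D.toDomains), CubeRowsGDirCY x.toKIdx c' U dB B δ α)
    {BcA δ₀ : ℝ} (hBc : (coordBound39 (trBasis N) * ∑ j, ‖trBasis N j‖) ^ 2 * (B * B6.c1 dB δ α) ≤ BcA) (hδ₀ : δ₀ ≤ (1 - α) * δ) :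
    (∀ j, HasMajorant (g := toB6 (geoBY x) 1 H) (fun p' : FBondY x.toKIdx × TrIdx N => blkV1 x.toKIdx.hN x.toKIdx.D p'.1)
        (conj (trBasis N) (((GDirCKY x.toKIdx j (DPDsDirCubeY x.toKIdx j (B9Cor35GpDirInputsAtOne.dirDomY x.toKIdx j))
          (bondsOverY x.toKIdx (B9Cor35GpDirInputsAtOne.dirDomY x.toKIdx j))) U).restrictScalars ℝ))
        (fun s s' => BcA * (geoBY x).len s ^ 2 * Real.exp (-(δ₀ * (geoBY x).dist s s')))) ∧
    (∀ j (ν : Fin (θd + 1)), HasMajorant (g := toB6 (geoBY x) 1 H) (fun p' : FBondY x.toKIdx × TrIdx N => blkV1 x.toKIdx.hN x.toKIdx.D p'.1)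
        (conj (trBasis N) (B9CoReadingCoords.cdBₗ x.toKIdx U ν) *
          conj (trBasis N) (((GDirCKY x.toKIdx j (DPDsDirCubeY x.toKIdx j (B9Cor35GpDirInputsAtOne.dirDomY x.toKIdx j))
            (bondsOverY x.toKIdx (B9Cor35GpDirInputsAtOne.dirDomY x.toKIdx j))) U).restrictScalars ℝ))
        (fun s s' => BcA * (geoBY x).len s * Real.exp (-(δ₀ * (geoBY x).dist s s')))) ∧
    (∀ j (ν : Fin (θd + 1)), HasMajorant (g := toB6 (geoBY x) 1 H) (fun p' : FBondY x.toKIdx × TrIdx N => blkV1 x.toKIdx.hN x.toKIdx.D p'.1)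
        (conj (trBasis N) (((GDirCKY x.toKIdx j (DPDsDirCubeY x.toKIdx j (B9Cor35GpDirInputsAtOne.dirDomY x.toKIdx j))
            (bondsOverY x.toKIdx (B9Cor35GpDirInputsAtOne.dirDomY x.toKIdx j))) U).restrictScalars ℝ) *
          conj (trBasis N) (B9CoReadingCoords.cdsBₗ x.toKIdx U ν))
        (fun s s' => BcA * (geoBY x).len s * Real.exp (-(δ₀ * (geoBY x).dist s s')))) ∧
    (∀ j, HasMajorant (g := toB6 (geoBY x) 1 H) (fun p' : FBondY x.toKIdx × TrIdx N => blkV1 x.toKIdx.hN x.toKIdx.D p'.1)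
        (conj (trBasis N) (B9CoReadingCoords.lapBₗ x.toKIdx U) *
          conj (trBasis N) (((GDirCKY x.toKIdx j (DPDsDirCubeY x.toKIdx j (B9Cor35GpDirInputsAtOne.dirDomY x.toKIdx j))
            (bondsOverY x.toKIdx (B9Cor35GpDirInputsAtOne.dirDomY x.toKIdx j))) U).restrictScalars ℝ))
        (fun s s' => BcA * 1 * Real.exp (-(δ₀ * (geoBY x).dist s s')))) := by
  letI : Fintype (geoBK x.toKIdx).Site := (inferInstance : Fintype (geoBY x).Site)
  have key := fun c' : ↥(cubes x.toKIdx.D.toDomains) => gDirCK_rows_at_member_of_cubeRows x.toKIdx c' 1 H hB hδ hα1 (h c')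
  have hBm : 0 ≤ (coordBound39 (trBasis N) * ∑ j, ‖trBasis N j‖) ^ 2 * (B * B6.c1 dB δ α) :=
    mul_nonneg (sq_nonneg _) (mul_nonneg hB (c1_nonneg _ _ _))
  have hlen : ∀ a : (geoBK x.toKIdx).Site, 0 ≤ (geoBK x.toKIdx).len a := fun a => (geoBK_len_pos x.toKIdx a).le
  have hdist : ∀ a a' : (geoBK x.toKIdx).Site, 0 ≤ (geoBK x.toKIdx).dist a a' := fun a a' => geoBK_dist_nonneg x.toKIdx a a'
  refine ⟨fun c' => ?_, fun c' ν => ?_, fun c' ν => ?_, fun c' => ?_⟩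
  · exact hasMajorant_mono _ (key c').1 fun a a' => kernel_mono hBm hBc hδ₀ (pow_nonneg (hlen a) 2) (hdist a a')
  · exact hasMajorant_mono _ ((key c').2.1 ν) fun a a' => kernel_mono hBm hBc hδ₀ (hlen a) (hdist a a')
  · exact hasMajorant_mono _ ((key c').2.2.1 ν) fun a a' => kernel_mono hBm hBc hδ₀ (hlen a) (hdist a a')
  · exact hasMajorant_mono _ (key c').2.2.2 fun a a' => kernel_mono hBm hBc hδ₀ zero_le_one (hdist a a')

/-- ★★ **THE HEADS' REGIME ROW `hUnitA` AT A MEMBER `x` AND ITS CONFIGURATION `U`** from the deliverable at every cover cube. [cite: Balaban1985BackgroundPropagators, Cor. 3.6 p.408, p.409 l.3–5] -/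
theorem hUnitA_at_member_of_cubeRows {θd θℓ : ℕ} {θhd : 1 ≤ θd + 1} {θhL : Odd (θℓ + 1) ∧ 1 < θℓ + 1} {θb₀ θb₁ : ℝ}
    (x : MemberY θd θℓ θhd θhL θb₀ θb₁ Mstar) (U : CfgY (Matrix (Fin N) (Fin N) ℂ) x.toKIdx) {dB : ℕ} {B δ α : ℝ}
    (h : ∀ c' : ↥(cubes x.toKIdx.D.toDomains), CubeRowsGDirCY x.toKIdx c' U dB B δ α) (c' : ↥(cubes x.toKIdx.D.toDomains)) :
    IsUnit (padDeltaLocCY x.toKIdx c' (QknitCubeY x.toKIdx c') (QsknitCubeY x.toKIdx c') (DPDsDirCubeY x.toKIdx c' (B9Cor35GpDirInputsAtOne.dirDomY x.toKIdx c'))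
      (bondsOverY x.toKIdx (B9Cor35GpDirInputsAtOne.dirDomY x.toKIdx c')) U) :=
  hUnitA_of_cubeRows x.toKIdx c' (h c')

end Heads

/-! ## §4 (v1.1)  How the supplier inhabits `CubeRowsGDirCY`: at `Ṽ := Uᵘ`, or at a cut small field `cutCfgS i T η A` with `T` one layer beyond the reading set -/

section Inhabit

open B6GlobalChartV1 (PV boxEquiv)
open B9Eq39Adjoint (fluct)
open B9Eq360DeltaPrimeAY (AfldY)
open B9Eq337CutFieldDirY (cutCfgS UboxY_cutCfgS_of_mem)
open B9BondReadDomainsPinY (nearAPinCY bondReadSetY_subset_nearAPinCY knitDep_src_mem_nearAPinCY)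
open B9CubeDirInverseBondCLocalityAtRecordY (agreeDirCY_of_agree310WalkYO)
open B9CubeLettersBondOpsL0 (IBondCubeY)

variable (i : KIdx d ℓ hd hL b₀ b₁) (c : ↥(cubes (toKT i).D.toDomains))

/-- `AgreeDirCY` is reflexive (every clause is an equality of readings of one configuration). [cite: Balaban1985BackgroundPropagators, p.410 l.14–15, bookkeeping] -/
theorem agreeDirCY_refl {𝔸 : Type} [NormedRing 𝔸] [NormedAlgebra ℂ 𝔸] [CompleteSpace 𝔸] (D : IBondCubeY i c → Set (FBondY i)) (S : Finset (SiteY i)) (W : CfgY 𝔸 i) :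
    AgreeDirCY i c D S W W :=
  ⟨fun _ _ _ => ⟨rfl, rfl⟩, fun _ _ _ => rfl, fun _ _ _ _ => ⟨rfl, rfl, rfl, rfl⟩, fun _ _ _ _ => rfl⟩

/-- ★ **THE BUNDLE FROM ROWS PROVED DIRECTLY AT `Ṽ := Uᵘ`** (dag-n06-c's UNIT-10 pattern for the site letter): no agreement clause to check.
[cite: Balaban1985BackgroundPropagators, Cor. 3.6 p.408 («applied to the configuration U′ = Uᵘ»), p.409 l.1–5] -/
theorem cubeRowsGDirCY_of_gauge {U : CfgY (Matrix (Fin N) (Fin N) ℂ) i} {u : GaugeY (Matrix (Fin N) (Fin N) ℂ) i}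
    (hg : ∀ z, u z ∈ unitaryUnits (Matrix (Fin N) (Fin N) ℂ)) {dB : ℕ} {B δ α : ℝ} (Rr : ℝ) (Hc : Prop)
    (h261 : Ineq261 dB (toB6 (geoCK i c) Rr Hc) δ α)
    (hV : IsUnit (padDeltaLocCY i c (QknitCubeY i c) (QsknitCubeY i c) (DPDsDirCubeY i c (dirDomY i c)) (bondsOverY i (dirDomY i c)) (gaugeY i u U)))
    (E0 : HasMajorant (g := toB6 (geoCK i c) Rr Hc) (blkBK i c)
      (conj (trBasis N) ((GDirCKY i c (DPDsDirCubeY i c (dirDomY i c)) (bondsOverY i (dirDomY i c)) (gaugeY i u U)).restrictScalars ℝ))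
      (fun a s => B * (geoCK i c).len a ^ 2 * Real.exp (-(δ * (geoCK i c).dist a s))))
    (E1 : ∀ ν : Fin (d + 1), HasMajorant (g := toB6 (geoCK i c) Rr Hc) (blkBK i c)
      (conj (trBasis N) (cdBₗ i (gaugeY i u U) ν) *
        conj (trBasis N) ((GDirCKY i c (DPDsDirCubeY i c (dirDomY i c)) (bondsOverY i (dirDomY i c)) (gaugeY i u U)).restrictScalars ℝ))
      (fun a s => B * (geoCK i c).len a * Real.exp (-(δ * (geoCK i c).dist a s))))
    (E2 : ∀ ν : Fin (d + 1), HasMajorant (g := toB6 (geoCK i c) Rr Hc) (blkBK i c)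
      (conj (trBasis N) ((GDirCKY i c (DPDsDirCubeY i c (dirDomY i c)) (bondsOverY i (dirDomY i c)) (gaugeY i u U)).restrictScalars ℝ) *
        conj (trBasis N) (cdsBₗ i (gaugeY i u U) ν))
      (fun a s => B * (geoCK i c).len a * Real.exp (-(δ * (geoCK i c).dist a s))))
    (E3 : HasMajorant (g := toB6 (geoCK i c) Rr Hc) (blkBK i c)
      (conj (trBasis N) (lapBₗ i (gaugeY i u U)) *
        conj (trBasis N) ((GDirCKY i c (DPDsDirCubeY i c (dirDomY i c)) (bondsOverY i (dirDomY i c)) (gaugeY i u U)).restrictScalars ℝ))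
      (fun a s => B * Real.exp (-(δ * (geoCK i c).dist a s)))) :
    CubeRowsGDirCY i c U dB B δ α :=
  ⟨u, gaugeY i u U, Rr, Hc, hg, agreeDirCY_refl i c _ _ _, h261, hV, E0, E1, E2, E3⟩

/-- ★ **ON THE READ SITES, `Uᵘ` AND THE CUT FIELD HAVE THE SAME BOND VARIABLES**: if `T` contains every site of `near`, its forward neighbours and its backward neighbours, the
datum box `Q` covers the chart preimage of `T`, and `Uᵘ = e^{iηA}` on the bonds of `Q` (the (3.35) datum), then for `z ∈ near` the bond variables `(μ, z)` and `(μ, z − e_μ)` of `Uᵘ`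
and of `cutCfgS i T η A` coincide (✓`UboxY_cutCfgS_of_mem`). [cite: Balaban1985BackgroundPropagators, (3.35) p.396, p.408 («U′ = Uᵘ = e^{iηA}»), p.410 l.14–15] -/
theorem agree_read_gaugeY_cutCfgS {𝔸 : Type} [NormedRing 𝔸] [NormedAlgebra ℂ 𝔸] [CompleteSpace 𝔸] {near T : Finset (SiteY i)} {η : ℝ} {A : AfldY 𝔸 i}
    {u : GaugeY 𝔸 i} {U : CfgY 𝔸 i} {Q : Set (Site (PV d ℓ i.m i.K hd hL) 0)}
    (hT : ∀ z ∈ near, ∀ μ : Fin (d + 1), z ∈ T ∧ shiftY i μ z ∈ T ∧ (shiftY i μ).symm z ∈ T)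
    (hQ : ∀ z ∈ T, (boxEquiv i.hN).symm z ∈ Q)
    (hgA : ∀ (κ : Fin (d + 1)) (x : Site (PV d ℓ i.m i.K hd hL) 0), x ∈ Q → x.shift κ ∈ Q → gaugeY i u U κ x = fluct η A κ x) :
    ∀ z ∈ near, ∀ μ : Fin (d + 1), UboxY i (gaugeY i u U) μ z = UboxY i (cutCfgS i T η A) μ z ∧
      UboxY i (gaugeY i u U) μ ((shiftY i μ).symm z) = UboxY i (cutCfgS i T η A) μ ((shiftY i μ).symm z) := fun z hz μ =>
  ⟨(UboxY_cutCfgS_of_mem i hQ hgA (hT z hz μ).1 (hT z hz μ).2.1).symm,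
    (UboxY_cutCfgS_of_mem i hQ hgA (hT z hz μ).2.2 (by rw [Equiv.apply_symm_apply]; exact (hT z hz μ).1)).symm⟩

variable {Mstar : ℕ}

omit [Nonempty (Fin N)] in
/-- ★★ **`AgreeDirCY Ω₀(□) (Uᵘ) (cutCfgS T η A)` FOR `T` ONE LAYER BEYOND THE PINNED READING SET** `nearAPinCY □ Ω₀(□)` (✓«KE₁₉X-C»'s pin): the four clauses of
`AgreeDirCY` through ✓`agreeDirCY_of_agree310WalkYO` (with `bondReadSetY ⊆ nearAPinCY`, `knitDep` sources `∈ nearAPinCY`) from the sitewise agreement of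
`agree_read_gaugeY_cutCfgS`.  LOCATED-35: `T = Ω₀(□)` would NOT do — the plaquettes through the bonds over `Ω₀` have edges leaving `Ω₀`, read by the hessian ∕ curvature
part of `Δ_{loc,□}`. [cite: Balaban1985BackgroundPropagators, p.410 l.14–15 («depend on U restricted to Ω₀(□) ⊂ □̃⁵»), (3.10) p.392, (3.35) p.396, Cor. 3.6 p.408] -/
theorem agreeDirCY_gaugeY_cutCfgS {θd θℓ : ℕ} {θhd : 1 ≤ θd + 1} {θhL : Odd (θℓ + 1) ∧ 1 < θℓ + 1} {θb₀ θb₁ : ℝ}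
    (x : MemberY θd θℓ θhd θhL θb₀ θb₁ Mstar) (q : ↥(cubes x.toKIdx.D.toDomains)) {T : Finset (SiteY x.toKIdx)} {η : ℝ}
    {A : AfldY (Matrix (Fin N) (Fin N) ℂ) x.toKIdx} {u : GaugeY (Matrix (Fin N) (Fin N) ℂ) x.toKIdx} {U : CfgY (Matrix (Fin N) (Fin N) ℂ) x.toKIdx}
    {Q : Set (Site (PV θd θℓ x.toKIdx.m x.toKIdx.K θhd θhL) 0)}
    (hT : ∀ z ∈ nearAPinCY x.toKIdx q (dirDomY x.toKIdx q), ∀ μ : Fin (θd + 1), z ∈ T ∧ shiftY x.toKIdx μ z ∈ T ∧ (shiftY x.toKIdx μ).symm z ∈ T)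
    (hQ : ∀ z ∈ T, (boxEquiv x.toKIdx.hN).symm z ∈ Q)
    (hgA : ∀ (κ : Fin (θd + 1)) (y : Site (PV θd θℓ x.toKIdx.m x.toKIdx.K θhd θhL) 0), y ∈ Q → y.shift κ ∈ Q → gaugeY x.toKIdx u U κ y = fluct η A κ y) :
    AgreeDirCY x.toKIdx q (fun ι => knitDepP x.toKIdx ι.1) (dirDomY x.toKIdx q) (gaugeY x.toKIdx u U) (cutCfgS x.toKIdx T η A) :=
  agreeDirCY_of_agree310WalkYO x
    ⟨CfgY (Matrix (Fin N) (Fin N) ℂ) x.toKIdx, fun _ _ => 1, fun V _ => V, fun _ _ _ => True, fun _ _ _ => True, fun _ _ _ => True, fun _ _ _ => True⟩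
    (fun V => V) q (fun _ => nearAPinCY x.toKIdx q (dirDomY x.toKIdx q)) (dirDomY x.toKIdx q) (fun ι => knitDepP x.toKIdx ι.1)
    bondReadSetY_subset_nearAPinCY (fun ι hι b' hb' => knitDep_src_mem_nearAPinCY ι hι b' hb')
    (agree_read_gaugeY_cutCfgS x.toKIdx hT hQ hgA)

/-- ★★★ **THE BUNDLE FROM A CUT SMALL FIELD** (the road-(B5) shape): a unitary-valued gauge `u`, a potential `A`, a cut set `T` one layer beyond `nearAPinCY □ Ω₀(□)`, a box `Q`
covering `T` with `Uᵘ = e^{iηA}` on its bonds, (2.61) on the cube geometry, the unit clause and the four rows AT `Ṽ := cutCfgS i T η A` give `CubeRowsGDirCY x.toKIdx □ U dB B δ α`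
— the supplier never touches `AgreeDirCY`. [cite: Balaban1985BackgroundPropagators, Cor. 3.6 p.408, Cor. 3.5 p.407, Thm 3.3 p.399, (3.35) p.396, p.409 l.1–5, p.410 l.14–15] -/
theorem cubeRowsGDirCY_of_cutDatum {θd θℓ : ℕ} {θhd : 1 ≤ θd + 1} {θhL : Odd (θℓ + 1) ∧ 1 < θℓ + 1} {θb₀ θb₁ : ℝ}
    (x : MemberY θd θℓ θhd θhL θb₀ θb₁ Mstar) (q : ↥(cubes x.toKIdx.D.toDomains)) {T : Finset (SiteY x.toKIdx)} {η : ℝ}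
    {A : AfldY (Matrix (Fin N) (Fin N) ℂ) x.toKIdx} {u : GaugeY (Matrix (Fin N) (Fin N) ℂ) x.toKIdx} {U : CfgY (Matrix (Fin N) (Fin N) ℂ) x.toKIdx}
    {Q : Set (Site (PV θd θℓ x.toKIdx.m x.toKIdx.K θhd θhL) 0)}
    (hg : ∀ z, u z ∈ unitaryUnits (Matrix (Fin N) (Fin N) ℂ))
    (hT : ∀ z ∈ nearAPinCY x.toKIdx q (dirDomY x.toKIdx q), ∀ μ : Fin (θd + 1), z ∈ T ∧ shiftY x.toKIdx μ z ∈ T ∧ (shiftY x.toKIdx μ).symm z ∈ T)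
    (hQ : ∀ z ∈ T, (boxEquiv x.toKIdx.hN).symm z ∈ Q)
    (hgA : ∀ (κ : Fin (θd + 1)) (y : Site (PV θd θℓ x.toKIdx.m x.toKIdx.K θhd θhL) 0), y ∈ Q → y.shift κ ∈ Q → gaugeY x.toKIdx u U κ y = fluct η A κ y)
    {dB : ℕ} {B δ α : ℝ} (Rr : ℝ) (Hc : Prop) (h261 : Ineq261 dB (toB6 (geoCK x.toKIdx q) Rr Hc) δ α)
    (hV : IsUnit (padDeltaLocCY x.toKIdx q (QknitCubeY x.toKIdx q) (QsknitCubeY x.toKIdx q) (DPDsDirCubeY x.toKIdx q (dirDomY x.toKIdx q))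
      (bondsOverY x.toKIdx (dirDomY x.toKIdx q)) (cutCfgS x.toKIdx T η A)))
    (E0 : HasMajorant (g := toB6 (geoCK x.toKIdx q) Rr Hc) (blkBK x.toKIdx q)
      (conj (trBasis N) ((GDirCKY x.toKIdx q (DPDsDirCubeY x.toKIdx q (dirDomY x.toKIdx q)) (bondsOverY x.toKIdx (dirDomY x.toKIdx q)) (cutCfgS x.toKIdx T η A)).restrictScalars ℝ))
      (fun a s => B * (geoCK x.toKIdx q).len a ^ 2 * Real.exp (-(δ * (geoCK x.toKIdx q).dist a s))))
    (E1 : ∀ ν : Fin (θd + 1), HasMajorant (g := toB6 (geoCK x.toKIdx q) Rr Hc) (blkBK x.toKIdx q)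
      (conj (trBasis N) (cdBₗ x.toKIdx (cutCfgS x.toKIdx T η A) ν) *
        conj (trBasis N) ((GDirCKY x.toKIdx q (DPDsDirCubeY x.toKIdx q (dirDomY x.toKIdx q)) (bondsOverY x.toKIdx (dirDomY x.toKIdx q)) (cutCfgS x.toKIdx T η A)).restrictScalars ℝ))
      (fun a s => B * (geoCK x.toKIdx q).len a * Real.exp (-(δ * (geoCK x.toKIdx q).dist a s))))
    (E2 : ∀ ν : Fin (θd + 1), HasMajorant (g := toB6 (geoCK x.toKIdx q) Rr Hc) (blkBK x.toKIdx q)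
      (conj (trBasis N) ((GDirCKY x.toKIdx q (DPDsDirCubeY x.toKIdx q (dirDomY x.toKIdx q)) (bondsOverY x.toKIdx (dirDomY x.toKIdx q)) (cutCfgS x.toKIdx T η A)).restrictScalars ℝ) *
        conj (trBasis N) (cdsBₗ x.toKIdx (cutCfgS x.toKIdx T η A) ν))
      (fun a s => B * (geoCK x.toKIdx q).len a * Real.exp (-(δ * (geoCK x.toKIdx q).dist a s))))
    (E3 : HasMajorant (g := toB6 (geoCK x.toKIdx q) Rr Hc) (blkBK x.toKIdx q)
      (conj (trBasis N) (lapBₗ x.toKIdx (cutCfgS x.toKIdx T η A)) *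
        conj (trBasis N) ((GDirCKY x.toKIdx q (DPDsDirCubeY x.toKIdx q (dirDomY x.toKIdx q)) (bondsOverY x.toKIdx (dirDomY x.toKIdx q)) (cutCfgS x.toKIdx T η A)).restrictScalars ℝ))
      (fun a s => B * Real.exp (-(δ * (geoCK x.toKIdx q).dist a s)))) :
    CubeRowsGDirCY x.toKIdx q U dB B δ α :=
  ⟨u, cutCfgS x.toKIdx T η A, Rr, Hc, hg, agreeDirCY_gaugeY_cutCfgS x q hT hQ hgA, h261, hV, E0, E1, E2, E3⟩

end Inhabit

/-! ## §5 (v1.2)  The canonical cut set `T := bondCutSetY i □` and the bond datum `DatumBondUY` (one (3.35) datum serving the site AND the bond rows) -/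

section BondCut

open B6GlobalChartV1 (PV boxEquiv)
open B9Eq39Adjoint (fluct covD)
open B9Eq360DeltaPrimeAY (AfldY)
open B9BackgroundsKLevelV1 (shiftsV1)
open B9Eq337CutFieldDirY (cutCfgS)
open B9BondReadDomainsPinY (nearAPinCY bondReadSetY_subset_nearAPinCY)
open B9CubeDirInverseBondLocalityAtRecordY (mem_bondReadSetY_self)
open B9Cor36GpDirMemberBlocksAtRecordY (Datum36UY)
open B6KLevelCensusIndexV1 (kGeo)
open B7Prop2Explicit (C0 c2')
open B7Prop3Flat (c3)

variable (i : KIdx d ℓ hd hL b₀ b₁) (q : ↥(cubes (toKT i).D.toDomains))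

/-- ★ **THE CANONICAL CUT SET OF THE BOND LETTER**: the pinned reading set `nearAPinCY □ Ω₀(□)` together with its translates `z ± e_μ` — the smallest `T` with the
one-layer property `hT` of `cubeRowsGDirCY_of_cutDatum` (LOCATED-35: the small field of road (B5) is cut HERE, not at `Ω₀(□)`).  OURS (a named site set).
[cite: Balaban1985BackgroundPropagators, p.410 l.14–15 («Ω₀(□) ⊂ □̃⁵»), (3.10) p.392, p.408] -/
def bondCutSetY : Finset (SiteY i) :=
  nearAPinCY i q (dirDomY i q) ∪ (Finset.univ ×ˢ nearAPinCY i q (dirDomY i q)).image (fun p : Fin (d + 1) × SiteY i => shiftY i p.1 p.2) ∪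
    (Finset.univ ×ˢ nearAPinCY i q (dirDomY i q)).image (fun p : Fin (d + 1) × SiteY i => (shiftY i p.1).symm p.2)

/-- the one-layer property `hT` of §4 for the canonical cut set. [cite: Balaban1985BackgroundPropagators, p.410 l.14–15, bookkeeping] -/
theorem hT_bondCutSetY : ∀ z ∈ nearAPinCY i q (dirDomY i q), ∀ μ : Fin (d + 1),
    z ∈ bondCutSetY i q ∧ shiftY i μ z ∈ bondCutSetY i q ∧ (shiftY i μ).symm z ∈ bondCutSetY i q := fun z hz μ => by
  unfold bondCutSetY
  simp only [Finset.mem_union]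
  exact ⟨Or.inl (Or.inl hz), Or.inl (Or.inr (Finset.mem_image.2 ⟨(μ, z), Finset.mem_product.2 ⟨Finset.mem_univ _, hz⟩, rfl⟩)),
    Or.inr (Finset.mem_image.2 ⟨(μ, z), Finset.mem_product.2 ⟨Finset.mem_univ _, hz⟩, rfl⟩)⟩

/-- `Ω₀(□) ⊆ bondCutSetY i □` (`Ω₀ ⊆ bondReadSetY Ω₀ ⊆ nearAPinCY`). [cite: Balaban1985BackgroundPropagators, p.410 l.14–15, bookkeeping] -/
theorem dirDomY_subset_bondCutSetY : dirDomY i q ⊆ bondCutSetY i q := fun z hz =>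
  (hT_bondCutSetY i q z (bondReadSetY_subset_nearAPinCY (mem_bondReadSetY_self hz)) 0).1

/-- ★ **THE (3.35) DATUM OF THE BOND LETTER AT `(□, U)`** — dag-n06-c's unitary site datum ✓`Datum36UY i □ U a₁` VERBATIM except that the box clause
`Q ⊇ chart⁻¹Ω₀(□)` is strengthened to `Q ⊇ chart⁻¹(bondCutSetY i □)` (the bond letter reads one plaquette layer beyond `Ω₀(□)`): a unitary gauge `g`, a potential `A`, a box `Q`
with `Uᵍ = e^{iηA}` on the bonds of `Q`, `‖A‖ ≤ Cξ⁻¹`, `‖η⁻¹∂A‖ ≤ Cξ⁻²` on `Q`, the scale rows and p06's window numerics at `α₀′`, `2CΛ² ≤ min(a₁, ¼)`.  ONE datum for both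
sectors (`datum36UY_of_datumBondUY`).  OURS (bundling). [cite: Balaban1985BackgroundPropagators, (3.35) p.396, Cor. 3.6 p.408 («Ω′₀ ⊂ □̃ for a cube □ of the class»), p.410 l.14–15] -/
def DatumBondUY (U : CfgY (Matrix (Fin N) (Fin N) ℂ) i) (a₁ : ℝ) : Prop :=
  ∃ (g : GaugeY (Matrix (Fin N) (Fin N) ℂ) i) (A : AfldY (Matrix (Fin N) (Fin N) ℂ) i) (Q : Set (Site (PV d ℓ i.m i.K hd hL) 0)) (C ξ Λ α₀' : ℝ),
    (∀ x, g x ∈ unitaryUnits (Matrix (Fin N) (Fin N) ℂ)) ∧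
    0 ≤ C ∧ (kGeo i).eta ≤ ξ ∧ 1 ≤ Λ ∧ LatticeNorms.scaleLen ((ℓ : ℝ) + 1) (kGeo i).eta (q.1.1 + 1) ≤ Λ * ξ ∧
    (∀ z ∈ bondCutSetY i q, (boxEquiv i.hN).symm z ∈ Q) ∧
    (∀ (κ : Fin (d + 1)) (x : Site (PV d ℓ i.m i.K hd hL) 0), x ∈ Q → x.shift κ ∈ Q → gaugeY i g U κ x = fluct (kGeo i).eta A κ x) ∧
    (∀ κ, ∀ x ∈ Q, ‖A κ x‖ ≤ C * ξ⁻¹) ∧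
    (∀ μ ν, ∀ x ∈ Q, ‖(((kGeo i).eta : ℂ)⁻¹) • covD (shiftsV1 (PV d ℓ i.m i.K hd hL)) (fun _ _ => (1 : (Matrix (Fin N) (Fin N) ℂ)ˣ)) μ (A ν) x‖ ≤ C * (ξ ^ 2)⁻¹) ∧
    2 * C * Λ ^ 2 ≤ a₁ ∧ 2 * C * Λ ^ 2 ≤ 1 / 4 ∧
    0 < α₀' ∧ C0 (d + 1) * α₀' ≤ 1 / 3 ∧ 4 * α₀' ≤ c2' (d + 1) (ℓ + 1) ∧
    Real.exp (4 * (800 * (((d + 1 : ℕ) : ℝ) + 1) ^ 2 * (((d + 1 : ℕ) : ℝ) + 4)) * α₀') * (1 + 8 * (131072 * (((d + 1 : ℕ) : ℝ) + 1) ^ 2) * (2 * C * Λ ^ 2)) ≤ 2 ∧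
    2 * (2 * C * Λ ^ 2) ≤ c3 (d + 1) (ℓ + 1) ∧ 4096 * ((d + 1 : ℕ) : ℝ) * (2 * C * Λ ^ 2) ≤ 1

omit [Nonempty (Fin N)] in
/-- ★ **ONE DATUM FOR BOTH SECTORS**: the bond datum is a site datum (`Ω₀(□) ⊆ bondCutSetY i □`). [cite: Balaban1985BackgroundPropagators, (3.35) p.396, Cor. 3.6 p.408, bookkeeping] -/
theorem datum36UY_of_datumBondUY {U : CfgY (Matrix (Fin N) (Fin N) ℂ) i} {a₁ : ℝ} (h : DatumBondUY i q U a₁) : Datum36UY i q U a₁ := by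
  obtain ⟨g, A, Q, C, ξ, Λ, α₀', hu, hC, hξ, hΛ, hΛξ, hQ, hgA, hA, hdA, hα₁, hα4, hα', hα3, hα4', hsmall, hc₃, hsm⟩ := h
  exact ⟨g, A, Q, C, ξ, Λ, α₀', hu, hC, hξ, hΛ, hΛξ, fun z hz => hQ z (dirDomY_subset_bondCutSetY i q hz), hgA, hA, hdA, hα₁, hα4, hα', hα3, hα4', hsmall, hc₃, hsm⟩

variable {Mstar : ℕ}

/-- ★★ **THE BUNDLE AT THE CANONICAL CUT**: §4's `cubeRowsGDirCY_of_cutDatum` at `T := bondCutSetY x.toKIdx □` (its `hT` is `hT_bondCutSetY`) — a unitary `u`, a potential `A`, a box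
`Q ⊇ chart⁻¹(bondCutSetY)` with `Uᵘ = e^{iηA}` on its bonds, (2.61), the unit clause and the four rows at `cutCfgS x.toKIdx (bondCutSetY x.toKIdx □) η A`.
[cite: Balaban1985BackgroundPropagators, Cor. 3.6 p.408, Cor. 3.5 p.407, Thm 3.3 p.399, (3.35) p.396, p.409 l.1–5, p.410 l.14–15] -/
theorem cubeRowsGDirCY_of_bondCut {θd θℓ : ℕ} {θhd : 1 ≤ θd + 1} {θhL : Odd (θℓ + 1) ∧ 1 < θℓ + 1} {θb₀ θb₁ : ℝ}
    (x : MemberY θd θℓ θhd θhL θb₀ θb₁ Mstar) (c : ↥(cubes x.toKIdx.D.toDomains)) {η : ℝ}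
    {A : AfldY (Matrix (Fin N) (Fin N) ℂ) x.toKIdx} {u : GaugeY (Matrix (Fin N) (Fin N) ℂ) x.toKIdx} {U : CfgY (Matrix (Fin N) (Fin N) ℂ) x.toKIdx}
    {Q : Set (Site (PV θd θℓ x.toKIdx.m x.toKIdx.K θhd θhL) 0)}
    (hg : ∀ z, u z ∈ unitaryUnits (Matrix (Fin N) (Fin N) ℂ))
    (hQ : ∀ z ∈ bondCutSetY x.toKIdx c, (boxEquiv x.toKIdx.hN).symm z ∈ Q)
    (hgA : ∀ (κ : Fin (θd + 1)) (y : Site (PV θd θℓ x.toKIdx.m x.toKIdx.K θhd θhL) 0), y ∈ Q → y.shift κ ∈ Q → gaugeY x.toKIdx u U κ y = fluct η A κ y)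
    {dB : ℕ} {B δ α : ℝ} (Rr : ℝ) (Hc : Prop) (h261 : Ineq261 dB (toB6 (geoCK x.toKIdx c) Rr Hc) δ α)
    (hV : IsUnit (padDeltaLocCY x.toKIdx c (QknitCubeY x.toKIdx c) (QsknitCubeY x.toKIdx c) (DPDsDirCubeY x.toKIdx c (dirDomY x.toKIdx c))
      (bondsOverY x.toKIdx (dirDomY x.toKIdx c)) (cutCfgS x.toKIdx (bondCutSetY x.toKIdx c) η A)))
    (E0 : HasMajorant (g := toB6 (geoCK x.toKIdx c) Rr Hc) (blkBK x.toKIdx c)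
      (conj (trBasis N) ((GDirCKY x.toKIdx c (DPDsDirCubeY x.toKIdx c (dirDomY x.toKIdx c)) (bondsOverY x.toKIdx (dirDomY x.toKIdx c))
        (cutCfgS x.toKIdx (bondCutSetY x.toKIdx c) η A)).restrictScalars ℝ))
      (fun a s => B * (geoCK x.toKIdx c).len a ^ 2 * Real.exp (-(δ * (geoCK x.toKIdx c).dist a s))))
    (E1 : ∀ ν : Fin (θd + 1), HasMajorant (g := toB6 (geoCK x.toKIdx c) Rr Hc) (blkBK x.toKIdx c)
      (conj (trBasis N) (cdBₗ x.toKIdx (cutCfgS x.toKIdx (bondCutSetY x.toKIdx c) η A) ν) *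
        conj (trBasis N) ((GDirCKY x.toKIdx c (DPDsDirCubeY x.toKIdx c (dirDomY x.toKIdx c)) (bondsOverY x.toKIdx (dirDomY x.toKIdx c))
          (cutCfgS x.toKIdx (bondCutSetY x.toKIdx c) η A)).restrictScalars ℝ))
      (fun a s => B * (geoCK x.toKIdx c).len a * Real.exp (-(δ * (geoCK x.toKIdx c).dist a s))))
    (E2 : ∀ ν : Fin (θd + 1), HasMajorant (g := toB6 (geoCK x.toKIdx c) Rr Hc) (blkBK x.toKIdx c)
      (conj (trBasis N) ((GDirCKY x.toKIdx c (DPDsDirCubeY x.toKIdx c (dirDomY x.toKIdx c)) (bondsOverY x.toKIdx (dirDomY x.toKIdx c))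
          (cutCfgS x.toKIdx (bondCutSetY x.toKIdx c) η A)).restrictScalars ℝ) *
        conj (trBasis N) (cdsBₗ x.toKIdx (cutCfgS x.toKIdx (bondCutSetY x.toKIdx c) η A) ν))
      (fun a s => B * (geoCK x.toKIdx c).len a * Real.exp (-(δ * (geoCK x.toKIdx c).dist a s))))
    (E3 : HasMajorant (g := toB6 (geoCK x.toKIdx c) Rr Hc) (blkBK x.toKIdx c)
      (conj (trBasis N) (lapBₗ x.toKIdx (cutCfgS x.toKIdx (bondCutSetY x.toKIdx c) η A)) *
        conj (trBasis N) ((GDirCKY x.toKIdx c (DPDsDirCubeY x.toKIdx c (dirDomY x.toKIdx c)) (bondsOverY x.toKIdx (dirDomY x.toKIdx c))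
          (cutCfgS x.toKIdx (bondCutSetY x.toKIdx c) η A)).restrictScalars ℝ))
      (fun a s => B * Real.exp (-(δ * (geoCK x.toKIdx c).dist a s)))) :
    CubeRowsGDirCY x.toKIdx c U dB B δ α :=
  cubeRowsGDirCY_of_cutDatum x c hg (hT_bondCutSetY x.toKIdx c) hQ hgA Rr Hc h261 hV E0 E1 E2 E3

end BondCut

end Literature.MathematicalPhysics.QuantumFieldTheory.Balaban1983to89.B9CubeDirInverseBondCMemberRowsAtRecordY

end
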